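import Literature.NumberTheory.EllipticCurves.NewformGaloisRep
import Literature.NumberTheory.EllipticCurves.DeligneSerreProp27Proofs
import Literature.NumberTheory.EllipticCurves.DeligneSerreProp27LevelDescentProofs
import Literature.NumberTheory.EllipticCurves.NewformsEigenpacketProofs
import HarnessLib

/-!
# Stub `stub_conjugateNewform` of line adelic-newform-datum-double-twist (crux stmt-Langlands-12944 `PhantomRMYoshida.SerreKWAutomorphicGL2`)

Route `PhantomRMYoshida`, crux `SerreKWAutomorphicGL2` (stmt-Langlands-12944), line
`adelic-newform-datum-double-twist`, Stub 3 `stub_conjugateNewform` (registered signature, verbatim):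
**Galois-conjugate eigenpackets of newforms are newform eigenpackets.**  For a newform
`f ∈ S_w(Γ₁(N))` and a ring embedding `τ : K_f →+* ℂ` of its coefficient field
`K_f = ℚ(aₙ(f), ε_f(n)) ⊆ ℂ` (`coeffCharField`) there are a level `M ≥ 1` and a newform
`g ∈ S_w(Γ₁(M))` whose Hecke polynomials `X² - a_q(g) X + ε_g(q) q^{w-1}` at the primes `q ∤ N M`
are the `τ`-conjugates `X² - τ(a_q(f)) X + τ(ε_f(q)) q^{w-1}` of those of `f`
(Diamond–Shurman Thm. 6.5.4; Shimura 1971 Thm. 3.48; Deligne–Serre 1974, Prop. 2.7 (2.7.4); in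
truth `M = N`, only the weak `∃ M` form is registered).

Proof (everything used is PROVED in the tree; no named fact is taken as a hypothesis):

1. `exists_conjEigenvector` — transport of the eigenvector `f` along `τ` (Deligne–Serre (2.7.4) read
   off (2.7.2)): the commuting family `𝒯 = {T_p : p prime} ∪ {⟨d⟩ : d ∈ (ℤ/Nℤ)ˣ}` preserves
   Deligne–Serre's lattice `L = integralLattice1 N w` (`heckeT_mem_integralLattice1`,
   `diamondOp_mem_integralLattice1`), which spans `S_w(Γ₁(N))`
   (`DeligneSerre1974_span_integralLattice1_holds`), so in the `ℂ`-basis `integralBasis` the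
   operators of `𝒯` have integer matrices; the eigenvalues `a_p(f)`
   (`IsNewform1.heckeEigenvalue_eq_coeff_holds`) and `ε_f(d)`
   (`IsNewform1.diamondOp_apply_eq_nebentypus_smul`) lie in `K_f` by construction, and
   `LatticeEigen.exists_eigenvector_conj` (with `σ := τ` itself, no extension needed) gives
   `g₁ ≠ 0` in `S_w(Γ₁(N))` with `T_p g₁ = τ(a_p) g₁`, `⟨d⟩ g₁ = τ(ε_f(d)) g₁`.
2. `exists_dirichletCharacter_conj` — the conjugate character `ε' = τ ∘ ε_f` mod `N`
   (`MulChar.ofUnitHom`), so `g₁ ∈ S_w(N, ε')` (`mem_nebentypusSubspace_iff_diamondOp`).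
3. Atkin–Lehner–Li (`exists_isNewform1_of_eigenpacket`): the packet `(τ(a_p))_{p ∤ N}, ε'` of `g₁`
   is the packet of a newform `g₀` of some level `M₀ ∣ N`, with `changeLevel (nebentypus g₀) = ε'`.
4. For `q ∤ N M₀` both Hecke polynomials are computed coefficientwise (`map_heckePolynomial`;
   `τ` fixes `q^{w-1}`; `ε_{g₀}(q) = ε'(q) = τ(ε_f(q))` by `DirichletCharacter.changeLevel_eq_cast_of_dvd`).

## References

* F. Diamond, J. Shurman, *A first course in modular forms*, GTM 228 (2005), Thm. 6.5.4, Thm. 5.8.2.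
* P. Deligne, J.-P. Serre, *Formes modulaires de poids 1*, Ann. Sci. ÉNS (4) 7 (1974), Prop. 2.7.
-/

noncomputable section

open scoped Polynomial
open NumberField Polynomial CongruenceSubgroup Literature.NumberTheory.EllipticCurves.ModularForms

namespace Summit.Langlands.Langlands.Cruxes.SerreKWAutomorphicGL2.AdelicNewformDatumDoubleTwist

-- `Summit.Langlands.Langlands.…` (summit = sub-problem name, D-0017 layout) trips `dupNamespace` on every decl.
set_option linter.dupNamespace false

variable {N : ℕ} [NeZero N] {w : ℤ}

/-- Every nebentypus value `ε_f(d)`, `d ∈ ℤ/Nℤ`, lies in the coefficient field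
`K_f = ℚ(aₙ(f), ε_f(n))` (by construction of `coeffCharField`, which adjoins the `ε_f(n)`,
`n ∈ ℕ`; every residue class is the class of a natural number). [folklore] -/
theorem nebentypus_apply_mem_coeffCharField (f : CuspForm (Gamma1 N) w) (d : ZMod N) :
    (nebentypus f d : ℂ) ∈ coeffCharField f := by
  have h := nebentypus_mem_coeffCharField f d.val
  rwa [ZMod.natCast_zmod_val] at h

/-- **Transport of a newform's eigenpacket along an embedding of its coefficient field**
(Deligne–Serre 1974, Prop. 2.7 (2.7.4), read off (2.7.2) as printed, p. 512): for a newform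
`f ∈ S_w(Γ₁(N))` and `τ : K_f →+* ℂ` there is `g ≠ 0` in `S_w(Γ₁(N))` with `T_p g = τ(a_p(f)) g`
for every prime `p` and `⟨d⟩ g = τ(ε_f(d)) g` for every unit `d`.  In the `ℂ`-basis of
`S_w(Γ₁(N))` given by a `ℤ`-basis of Deligne–Serre's lattice (`integralBasis`,
`DeligneSerre1974_span_integralLattice1_holds`) the `T_p` and `⟨d⟩` have integer matrices, and the
eigenvalues of `f` lie in `K_f`, so `LatticeEigen.exists_eigenvector_conj` applies with `σ = τ`.
[cite: DeligneSerreASENS1974, Prop. 2.7 (2.7.4), p. 512] -/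
theorem exists_conjEigenvector {f : CuspForm (Gamma1 N) w} (hf : IsNewform1 f)
    (τ : coeffCharField f →+* ℂ) :
    ∃ g : CuspForm (Gamma1 N) w, g ≠ 0 ∧
      (∀ (p : ℕ) (hp : p.Prime), (haveI : NeZero p := ⟨hp.ne_zero⟩; heckeT (Gamma1 N) w p g) =
          τ ⟨cuspCoeff f p, cuspCoeff_mem_coeffCharField f p⟩ • g) ∧
      ∀ d : (ZMod N)ˣ, diamondOp N w (d : ZMod N) g =
          τ ⟨(nebentypus f (d : ZMod N) : ℂ), nebentypus_apply_mem_coeffCharField f _⟩ • g := by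
  classical
  have hf0 : f ≠ 0 := hf.ne_zero
  rcases le_or_gt w 0 with hw | hw
  · exact absurd (cuspForm_eq_zero_of_weight_nonpos hw f) hf0
  have hw1 : (1 : ℤ) ≤ w := hw
  have hspan := DeligneSerre1974_span_integralLattice1_holds N w hw1
  have hTf : ∀ (p : ℕ) (hp : p.Prime),
      (haveI : NeZero p := ⟨hp.ne_zero⟩; heckeT (Gamma1 N) w p f) = cuspCoeff f p • f := by
    intro p hp
    haveI : NeZero p := ⟨hp.ne_zero⟩
    have h := heckeT_eq_heckeEigenvalue_smul f p (hf.2.1 p hp)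
    rwa [IsNewform1.heckeEigenvalue_eq_coeff_holds hf hp] at h
  have hdf : ∀ d : (ZMod N)ˣ, diamondOp N w (d : ZMod N) f = nebentypus f (d : ZMod N) • f :=
    hf.diamondOp_apply_eq_nebentypus_smul
  -- the operators `𝒯 = {T_p : p prime} ∪ {⟨d⟩}` and their eigenvalues on `f`
  set 𝒯 : Set (Module.End ℂ (CuspForm (Gamma1 N) w)) :=
    {T | ∃ (p : ℕ) (hp : p.Prime), T = (haveI : NeZero p := ⟨hp.ne_zero⟩; heckeT (Gamma1 N) w p)} ∪
      {T | ∃ d : (ZMod N)ˣ, T = diamondOp N w (d : ZMod N)} with h𝒯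
  have hTmem : ∀ (p : ℕ) (hp : p.Prime),
      (haveI : NeZero p := ⟨hp.ne_zero⟩; heckeT (Gamma1 N) w p) ∈ 𝒯 :=
    fun p hp ↦ Or.inl ⟨p, hp, rfl⟩
  have hdmem : ∀ d : (ZMod N)ˣ, diamondOp N w (d : ZMod N) ∈ 𝒯 := fun d ↦ Or.inr ⟨d, rfl⟩
  have hstab : ∀ T ∈ 𝒯, ∀ x ∈ integralLattice1 N w, T x ∈ integralLattice1 N w := by
    rintro T (⟨p, hp, rfl⟩ | ⟨d, rfl⟩) x hx
    · haveI : NeZero p := ⟨hp.ne_zero⟩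
      exact heckeT_mem_integralLattice1 hw1 hx p hp
    · exact diamondOp_mem_integralLattice1 hx d
  set lam : Module.End ℂ (CuspForm (Gamma1 N) w) → ℂ := LatticeEigen.eigenvalueOf f with hlam
  have hlam_p : ∀ (p : ℕ) (hp : p.Prime),
      lam (haveI : NeZero p := ⟨hp.ne_zero⟩; heckeT (Gamma1 N) w p) = cuspCoeff f p :=
    fun p hp ↦ LatticeEigen.eigenvalueOf_eq hf0 (hTf p hp)
  have hlam_d : ∀ d : (ZMod N)ˣ, lam (diamondOp N w (d : ZMod N)) = nebentypus f (d : ZMod N) :=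
    fun d ↦ LatticeEigen.eigenvalueOf_eq hf0 (hdf d)
  have hlam_eig : ∀ T ∈ 𝒯, T f = lam T • f := by
    rintro T (⟨p, hp, rfl⟩ | ⟨d, rfl⟩)
    · exact LatticeEigen.apply_eq_eigenvalueOf_smul ⟨_, hTf p hp⟩
    · exact LatticeEigen.apply_eq_eigenvalueOf_smul ⟨_, hdf d⟩
  -- the eigenvalues already lie in `K_f`
  have hlamK : ∀ T ∈ 𝒯, lam T ∈ coeffCharField f := by
    rintro T (⟨p, hp, rfl⟩ | ⟨d, rfl⟩)
    · rw [hlam_p p hp]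
      exact cuspCoeff_mem_coeffCharField f p
    · rw [hlam_d d]
      exact nebentypus_apply_mem_coeffCharField f _
  -- transport of the eigenvector `f` along `τ`
  set b := integralBasis N w hspan with hb
  have hrat : ∀ T ∈ 𝒯, ∀ i j, ∃ q : ℚ, b.repr (T (b j)) i = q := fun T hT i j ↦ by
    obtain ⟨n, hn⟩ := exists_int_repr_integralBasis hspan T (hstab T hT) i j
    exact ⟨n, by rw [hn, Rat.cast_intCast]⟩
  obtain ⟨g, hg0, hg⟩ :=
    LatticeEigen.exists_eigenvector_conj b 𝒯 hrat (coeffCharField f) τ hf0 lam hlamK hlam_eig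
  refine ⟨g, hg0, fun p hp ↦ ?_, fun d ↦ ?_⟩
  · rw [hg _ (hTmem p hp)]
    congr 1
    exact congrArg τ (Subtype.ext (hlam_p p hp))
  · rw [hg _ (hdmem d)]
    congr 1
    exact congrArg τ (Subtype.ext (hlam_d d))

/-- **The conjugate character `τ ∘ ε_f`** (Deligne–Serre 1974, (2.7.4): "si `f` est de type
`(k, ε)`, `σ(f)` est de type `(k, σ(ε))`"): for `f ∈ S_w(Γ₁(N))` and `τ : K_f →+* ℂ` there is a
Dirichlet character `ε'` modulo `N` with `ε'(x) = τ(ε_f(x))` for every unit `x` of `ℤ/Nℤ`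
(built from the unit-group homomorphism `d ↦ τ(ε_f(d))` by `MulChar.ofUnitHom`).
[cite: DeligneSerreASENS1974, Prop. 2.7 (2.7.4), p. 512] -/
theorem exists_dirichletCharacter_conj (f : CuspForm (Gamma1 N) w) (τ : coeffCharField f →+* ℂ) :
    ∃ ε' : DirichletCharacter ℂ N, ∀ x : ZMod N, IsUnit x →
      ε' x = τ ⟨(nebentypus f x : ℂ), nebentypus_apply_mem_coeffCharField f x⟩ := by
  classical
  set χ := nebentypus f with hχ
  set e : (ZMod N)ˣ → coeffCharField f :=
    fun d ↦ ⟨(χ (d : ZMod N) : ℂ), nebentypus_apply_mem_coeffCharField f _⟩ with he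
  have he_one : e 1 = 1 := Subtype.ext (by rw [he]; simp)
  have he_mul : ∀ d d' : (ZMod N)ˣ, e (d * d') = e d * e d' := fun d d' ↦
    Subtype.ext (by rw [he]; simp)
  have hne : ∀ d : (ZMod N)ˣ, τ (e d) ≠ 0 := by
    intro d h
    rw [map_eq_zero_iff τ τ.injective] at h
    have h' : (χ (d : ZMod N) : ℂ) = 0 := congrArg Subtype.val h
    rw [← MulChar.coe_toUnitHom] at h'
    exact (χ.toUnitHom d).ne_zero h'
  set ψ : (ZMod N)ˣ →* ℂˣ :=
    { toFun := fun d ↦ Units.mk0 _ (hne d)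
      map_one' := by
        ext
        rw [Units.val_mk0, Units.val_one, he_one, map_one]
      map_mul' := fun d d' ↦ by
        ext
        rw [Units.val_mul, Units.val_mk0, Units.val_mk0, Units.val_mk0, he_mul, map_mul] }
    with hψ
  refine ⟨MulChar.ofUnitHom ψ, ?_⟩
  rintro _ ⟨d, rfl⟩
  rw [MulChar.ofUnitHom_coe]
  rfl

/-- **Stub 3 (conjugate eigenpackets are newform eigenpackets).**  For a newform
`f ∈ S_w(Γ₁(N))` and a ring embedding `τ : K_f →+* ℂ` of its coefficient field there is a
newform `g ∈ S_w(Γ₁(M))` of the same weight and some level `M ≥ 1` whose Hecke polynomials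
`X² - a_q(g) X + ε_g(q) q^{w-1}` at the primes `q ∤ N M` are the `τ`-conjugates
`X² - τ(a_q(f)) X + τ(ε_f(q)) q^{w-1}` of those of `f` (Diamond–Shurman Thm. 6.5.4; in truth
`M = N` and `g = f^τ`; the weaker `∃ M` is all the line needs).  Proof: transport the eigenvector
`f` along `τ` in Deligne–Serre's integral basis (`exists_conjEigenvector`, (2.7.4) from the proved
(2.7.2)), read the diamond eigenvalues as the conjugate character `ε' = τ ∘ ε_f`
(`exists_dirichletCharacter_conj`), replace the resulting eigenform by the newform with the same
packet away from `N` (`exists_isNewform1_of_eigenpacket`, Atkin–Lehner–Li), and compare the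
Hecke polynomials coefficientwise (`map_heckePolynomial`, `changeLevel_eq_cast_of_dvd`).
[cite: DiamondShurman2005, Thm. 6.5.4 and Thm. 5.8.2] [cite: DeligneSerreASENS1974, Prop. 2.7] -/
theorem stub_conjugateNewform :
    ∀ (N : ℕ) [NeZero N] (w : ℤ) (f : CuspForm (Gamma1 N) w), IsNewform1 f →
      ∀ τ : coeffCharField f →+* ℂ,
        ∃ (M : ℕ) (_ : NeZero M) (g : CuspForm (Gamma1 M) w), IsNewform1 g ∧
          ∀ q : ℕ, q.Prime → ¬ q ∣ N * M →
            (heckePolynomial g q).map (algebraMap (coeffCharField g) ℂ) =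
              (heckePolynomial f q).map τ := by
  intro N _ w f hf τ
  classical
  obtain ⟨g₁, hg0, hgT, hgd⟩ := exists_conjEigenvector hf τ
  obtain ⟨ε', hε'⟩ := exists_dirichletCharacter_conj f τ
  have hgχ : g₁ ∈ nebentypusSubspace N w ε' := by
    rw [mem_nebentypusSubspace_iff_diamondOp]
    intro d
    rw [hgd d, hε' _ d.isUnit]
  obtain ⟨M₀, hM₀0, hM₀, g₀, hg₀, hcoeff, hchar⟩ :=
    exists_isNewform1_of_eigenpacket hg0 hgχ
      (a := fun p ↦ τ ⟨cuspCoeff f p, cuspCoeff_mem_coeffCharField f p⟩)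
      (fun p hp _ ↦ hgT p hp)
  refine ⟨M₀, hM₀0, g₀, hg₀, fun q hq hqNM ↦ ?_⟩
  have hqN : ¬ q ∣ N := fun h ↦ hqNM (dvd_mul_of_dvd_left h _)
  -- the coefficient `a_q(g₀) = τ(a_q(f))`
  have ha : (UpperHalfPlane.qExpansion 1 ⇑g₀).coeff q =
      τ ⟨cuspCoeff f q, cuspCoeff_mem_coeffCharField f q⟩ :=
    hcoeff q hq hqN
  -- the character value `ε_{g₀}(q) = ε'(q) = τ(ε_f(q))`
  have hε : (nebentypus g₀ (q : ZMod M₀) : ℂ) =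
      τ ⟨(nebentypus f (q : ZMod N) : ℂ), nebentypus_apply_mem_coeffCharField f _⟩ := by
    obtain ⟨u, hu⟩ := ZMod.isUnit_prime_of_not_dvd hq hqN
    have h1 : nebentypus g₀ (q : ZMod M₀) =
        DirichletCharacter.changeLevel hM₀ (nebentypus g₀) (q : ZMod N) := by
      rw [← hu, DirichletCharacter.changeLevel_eq_cast_of_dvd _ hM₀, hu, ZMod.cast_natCast hM₀]
    rw [h1, hchar]
    exact hε' _ (ZMod.isUnit_prime_of_not_dvd hq hqN)
  -- `τ` fixes `q^{w-1}`
  have hz : (((q : coeffCharField f) ^ (w - 1) : coeffCharField f) : ℂ) = (q : ℂ) ^ (w - 1) := by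
    have h := map_zpow₀ (algebraMap (coeffCharField f) ℂ) (q : coeffCharField f) (w - 1)
    rwa [map_natCast] at h
  have hsub : (⟨(nebentypus f (q : ZMod N) : ℂ) * (q : ℂ) ^ (w - 1),
        nebentypus_mul_zpow_mem_coeffCharField f q⟩ : coeffCharField f) =
      ⟨(nebentypus f (q : ZMod N) : ℂ), nebentypus_apply_mem_coeffCharField f _⟩ *
        (q : coeffCharField f) ^ (w - 1) :=
    Subtype.ext (by rw [MulMemClass.coe_mul, hz])
  have hconst : (nebentypus g₀ (q : ZMod M₀) : ℂ) * (q : ℂ) ^ (w - 1) =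
      τ ⟨(nebentypus f (q : ZMod N) : ℂ) * (q : ℂ) ^ (w - 1),
        nebentypus_mul_zpow_mem_coeffCharField f q⟩ := by
    rw [hsub, map_mul, map_zpow₀, map_natCast τ, hε]
  rw [map_heckePolynomial, heckePolynomial]
  simp only [Polynomial.map_add, Polynomial.map_sub, Polynomial.map_mul, Polynomial.map_pow,
    Polynomial.map_X, Polynomial.map_C]
  rw [ha, hconst]
  rfl

end Summit.Langlands.Langlands.Cruxes.SerreKWAutomorphicGL2.AdelicNewformDatumDoubleTwist

end
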